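import Literature.NumberTheory.Automorphic.OrdinaryPartOfCompleteModule
import HarnessLib

/-!
# Ordinary parts under injective equivariant maps and under reduction

Topic `NumberTheory/Automorphic`; namespace `Literature.NumberTheory.Automorphic`; theorems only,
continuing `OrdinaryPartOfCompleteModule`.  How Hida's ordinary parts `M^{ord} = ⋂ₖ range Uᵏ`
behave along the universal-coefficient injection `M/IⁿM ↪ N` (`M = H^q(Y, V_𝒪)`,
`N = H^q(Y, V_{𝒪/ϖⁿ})`; [Hida1994AIF, §3]; [KhareThorne2017, §6.4]):

* `mem_iInf_range_pow_iff_of_injective` — for an INJECTIVE (semilinear) map `j : M → N` of FINITE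
  modules intertwining `S` and `T`: `j x ∈ N^{T-ord} ↔ x ∈ M^{S-ord}` (Fitting decompositions);
* `map_iInf_range_pow_eq_of_injective` — `j(M^{ord}) = N^{ord} ∩ range j`;
* **`map_ordPart_eq_of_ker_eq`** — for `M` adically complete with finite truncations
  (`OrdinaryPartOfCompleteModule`), `N` finite and `r : M →ₛₗ N` intertwining `S`, `T` with
  `ker r = IⁿM`: **`r(M^{ord}) = N^{ord} ∩ range r`**.

## References

* H. Hida, Ann. Inst. Fourier 44 (1994), §3 (held). [Hida1994AIF]
* C. Khare, J. A. Thorne, Amer. J. Math. 139 (2017), §2.4, §6.4 (arXiv:1409.7007, held). [KhareThorne2017]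
-/

namespace Literature.NumberTheory.Automorphic

open Submodule

section Finite

variable {R R' : Type*} [Ring R] [Ring R'] {σ : R →+* R'} {M N : Type*} [AddCommGroup M] [Module R M]
  [AddCommGroup N] [Module R' N]

/-- **Ordinary parts along an injective equivariant map of finite modules**: `j x` is `T`-ordinary
iff `x` is `S`-ordinary. [cite: KhareThorne2017, §2.4 Lemma 2.10] -/
theorem mem_iInf_range_pow_iff_of_injective [Finite M] [Finite N] (j : M →ₛₗ[σ] N)
    (hj : Function.Injective j) (S : Module.End R M) (T : Module.End R' N) (h : ∀ x, j (S x) = T (j x))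
    (x : M) :
    j x ∈ (⨅ n : ℕ, LinearMap.range (T ^ n) : Submodule R' N) ↔
      x ∈ (⨅ n : ℕ, LinearMap.range (S ^ n) : Submodule R M) := by
  have hpow : ∀ (n : ℕ) (y : M), j ((S ^ n) y) = (T ^ n) (j y) := by
    intro n
    induction n with
    | zero => intro y; rfl
    | succ n ih => intro y; rw [pow_succ, pow_succ, Module.End.mul_apply, Module.End.mul_apply, ih, h]
  constructor
  · intro hx
    haveI : IsArtinian R M := isArtinian_of_finite
    haveI : IsArtinian R' N := isArtinian_of_finite
    have hM := S.isCompl_iSup_ker_pow_iInf_range_pow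
    have hN := T.isCompl_iSup_ker_pow_iInf_range_pow
    obtain ⟨a, ha, b, hb, rfl⟩ := Submodule.mem_sup.1 (show x ∈ (⨆ n, LinearMap.ker (S ^ n)) ⊔ ⨅ n, LinearMap.range (S ^ n) by
      rw [hM.sup_eq_top]; exact Submodule.mem_top)
    -- `j a` is `T`-ordinary and `T`-nilpotent, hence `0`
    have hja_ord : j a ∈ (⨅ n : ℕ, LinearMap.range (T ^ n) : Submodule R' N) := by
      have hjb : j b ∈ (⨅ n : ℕ, LinearMap.range (T ^ n) : Submodule R' N) := by
        simp only [Submodule.mem_iInf, LinearMap.mem_range] at hb ⊢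
        intro n
        obtain ⟨y, hy⟩ := hb n
        exact ⟨j y, by rw [← hpow, hy]⟩
      have : j a = j (a + b) - j b := by rw [map_add, add_sub_cancel_right]
      rw [this]
      exact sub_mem hx hjb
    have hja_nil : j a ∈ (⨆ n : ℕ, LinearMap.ker (T ^ n) : Submodule R' N) := by
      have hdirS : Directed (· ≤ ·) fun n : ℕ => LinearMap.ker (S ^ n) := S.iterateKer.monotone.directed_le
      have hdirT : Directed (· ≤ ·) fun n : ℕ => LinearMap.ker (T ^ n) := T.iterateKer.monotone.directed_le
      obtain ⟨n, hn⟩ := (Submodule.mem_iSup_of_directed _ hdirS).1 ha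
      refine (Submodule.mem_iSup_of_directed _ hdirT).2 ⟨n, ?_⟩
      rw [LinearMap.mem_ker] at hn ⊢
      rw [← hpow, hn, map_zero]
    have hja : j a = 0 := Submodule.disjoint_def.1 hN.disjoint _ hja_nil hja_ord
    have ha0 : a = 0 := hj (by rw [hja, map_zero])
    rw [ha0, zero_add]
    exact hb
  · intro hx
    simp only [Submodule.mem_iInf, LinearMap.mem_range] at hx ⊢
    intro n
    obtain ⟨y, hy⟩ := hx n
    exact ⟨j y, by rw [← hpow, hy]⟩

/-- **`j(M^{ord}) = N^{ord} ∩ range j`** for an injective equivariant map of finite modules.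
[cite: KhareThorne2017, §2.4 Lemma 2.10] -/
theorem map_iInf_range_pow_eq_of_injective [RingHomSurjective σ] [Finite M] [Finite N] (j : M →ₛₗ[σ] N)
    (hj : Function.Injective j) (S : Module.End R M) (T : Module.End R' N) (h : ∀ x, j (S x) = T (j x)) :
    (⨅ n : ℕ, LinearMap.range (S ^ n) : Submodule R M).map j =
      (⨅ n : ℕ, LinearMap.range (T ^ n) : Submodule R' N) ⊓ LinearMap.range j := by
  ext y
  simp only [Submodule.mem_map, Submodule.mem_inf, LinearMap.mem_range]
  constructor
  · rintro ⟨x, hx, rfl⟩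
    exact ⟨(mem_iInf_range_pow_iff_of_injective j hj S T h x).2 hx, x, rfl⟩
  · rintro ⟨hy, x, rfl⟩
    exact ⟨x, (mem_iInf_range_pow_iff_of_injective j hj S T h x).1 hy, rfl⟩

end Finite

section Complete

variable {R R' : Type*} [CommRing R] [CommRing R'] {σ : R →+* R'} [RingHomSurjective σ] {M N : Type*}
  [AddCommGroup M] [Module R M] [AddCommGroup N] [Module R' N] (I : Ideal R)
  [IsAdicComplete I M] [hfin : ∀ n : ℕ, Finite (M ⧸ (I ^ n • ⊤ : Submodule R M))] [Finite N]

include I in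
/-- **`r(M^{ord}) = N^{ord} ∩ range r`** for a (semilinear) map `r : M → N` to a finite module,
intertwining `S` and `T`, with kernel `IⁿM`, `M` adically complete with finite truncations — the
ordinary part of the reduction is the reduction of the ordinary part, inside the image.
[cite: Hida1994AIF, §3] [cite: KhareThorne2017, §6.4] -/
theorem map_ordPart_eq_of_ker_eq (S : Module.End R M) (T : Module.End R' N) (r : M →ₛₗ[σ] N)
    (h : ∀ x, r (S x) = T (r x)) (n : ℕ) (hker : LinearMap.ker r = (I ^ n • ⊤ : Submodule R M)) :
    (ordPart S).map r = ordPart T ⊓ LinearMap.range r := by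
  -- factor `r` through the truncation
  have hle : (I ^ n • ⊤ : Submodule R M) ≤ LinearMap.ker r := hker.ge
  let j : (M ⧸ (I ^ n • ⊤ : Submodule R M)) →ₛₗ[σ] N := (I ^ n • ⊤ : Submodule R M).liftQ r hle
  have hj : Function.Injective j := by
    rw [← LinearMap.ker_eq_bot]
    refine (Submodule.eq_bot_iff _).2 fun q hq => ?_
    obtain ⟨x, rfl⟩ := Submodule.Quotient.mk_surjective _ q
    rw [LinearMap.mem_ker, Submodule.liftQ_apply] at hq
    exact (Submodule.Quotient.mk_eq_zero _).2 (hker.le hq)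
  have hjS : ∀ q, j (truncEnd I S n q) = T (j q) := fun q => by
    obtain ⟨x, rfl⟩ := Submodule.Quotient.mk_surjective _ q
    rw [modPow_mk, Submodule.liftQ_apply, Submodule.liftQ_apply, h]
  have hr : r = j ∘ₛₗ (I ^ n • ⊤ : Submodule R M).mkQ := by
    refine LinearMap.ext fun x => ?_
    rfl
  have hrange : LinearMap.range r = LinearMap.range j := by
    rw [hr]
    exact LinearMap.range_comp_of_range_eq_top _ (Submodule.range_mkQ _)
  rw [hr, Submodule.map_comp, map_mkQ_ordPart I S n, ordMod, map_iInf_range_pow_eq_of_injective j hj _ T hjS,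
    ← hrange, hr]
  rfl

end Complete

end Literature.NumberTheory.Automorphic
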